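import Mathlib
import Summits.ValiantsHypothesis.ValiantsHypothesis.Theorems.DivisionGapDefs
import Summits.ValiantsHypothesis.ValiantsHypothesis.Theorems.DivisionGapPerCofactorDegreeReductionStubMemberDescent
import Literature.Computability.AlgebraicComplexity.ValiantClassesProofs
import Literature.Computability.AlgebraicComplexity.PermanentIrreducible

/-!
# `DivisionGap.PerCofactorDegreeReduction` (stmt-ValiantsHypothesis-15046), line `Sketch_ideator4`
(idea intrinsic-member-descent): the GADGET PROJECTION (stub `stub_gadgetProjection`, F2)

Cells are `(row, col)`; a permutation `σ : Equiv.Perm (Fin n)` is the perfect matching with cells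
`(σ i, i)`, and `facePer A` is the perfect-matching polynomial of the cell set `A`.  The host `A`
contains a PLACED GADGET: core rows `ra a`, core columns `cb b'`, for each pair `p = (a, b')` the
chord path `ra a — xc p — yr p — cb b'` (cells `(ra p.1, xc p)`, `(yr p, xc p)`, `(yr p, cb p.2)`),
and every LEFTOVER column `c` (neither a `cb` nor an `xc`) is matched to a leftover row `μ c` by a
cell of `A`.  The substitution `x_{(ra a, xc (a, b'))} ↦ X_{(a, b')}`, `x_{(yr p, xc p)} ↦ 1`,
`x_{(yr p, cb p.2)} ↦ 1`, `x_{(μ c, c)} ↦ 1` (`c` leftover), every other variable `↦ 0`, is a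
Valiant projection (free, `complexity_le_of_isProjection`) sending `per_A` to `per_b`: a matching
of `A` survives iff all its cells are designated; the survivors are exactly the LIFTS `σ_g` of the
permutations `g` of `Fin b` (`cb b' ↦ yr (g b', b')`, `xc (g b', b') ↦ ra (g b')`, the other
`xc p ↦ yr p`, leftover `c ↦ μ c`), and `σ_g ↦ ∏_{b'} X_{(g b', b')} = x^{μ_g}`.  No definitions:
the substitution and the lifts enter the lemmas as parameters characterised by hypotheses.
[folklore]
-/

noncomputable section

-- `Summit.ValiantsHypothesis.ValiantsHypothesis.…` is the tree's mandated single-conjunct layout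
-- (Sub = Summit), so the duplicated namespace component is intended.
set_option linter.dupNamespace false

open MvPolynomial Literature.Computability.AlgebraicComplexity
open Summit.ValiantsHypothesis.ValiantsHypothesis.Theorems.DivisionGapPerDivisionHard (facePer)
open scoped NNReal

namespace Summit.ValiantsHypothesis.ValiantsHypothesis.Theorems.DivisionGap.PerCofactorDegreeReduction.GadgetProjection

variable {n b : ℕ} {A : Finset (Fin n × Fin n)} {ra cb : Fin b → Fin n}
  {xc yr : Fin b × Fin b → Fin n} {μ : Equiv.Perm (Fin n)}

/-- The permutation monomial `x^{μ_ρ}` is the product `∏_i X_{(ρ i, i)}`. [folklore] -/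
theorem monomial_permMonomial_eq_prod {ι : Type*} [Fintype ι] [DecidableEq ι]
    (ρ : Equiv.Perm ι) :
    (monomial (permMonomial ρ) (1 : ℝ≥0) : MvPolynomial (ι × ι) ℝ≥0) = ∏ i, X (ρ i, i) := by
  rw [permMonomial, monomial_sum_one]
  rfl

/-- Every column is a core column `cb b'`, a path column `xc p`, or a leftover column. [folklore] -/
theorem col_cases (cb : Fin b → Fin n) (xc : Fin b × Fin b → Fin n) (i : Fin n) :
    (∃ b', i = cb b') ∨ (∃ p, i = xc p) ∨ ((∀ b', cb b' ≠ i) ∧ ∀ p, xc p ≠ i) :=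
  or_iff_not_imp_left.2 fun h1 => or_iff_not_imp_left.2 fun h2 =>
    ⟨fun b' h => h1 ⟨b', h.symm⟩, fun p h => h2 ⟨p, h.symm⟩⟩

/-! ### The gadget substitution -/

/-- **The gadget substitution exists** and is a Valiant projection:
`x_{(ra a, xc (a,b'))} ↦ X_{(a,b')}`, the other chord cells and the leftover matching cells `↦ 1`,
everything else `↦ 0`; a variable with nonzero image sits on a designated cell. [folklore] -/
theorem exists_subst (hxc : Function.Injective xc) (hry : ∀ a p, ra a ≠ yr p) :
    ∃ φ : Fin n × Fin n → MvPolynomial (Fin b × Fin b) ℝ≥0,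
      (∀ e, (∃ j, φ e = X j) ∨ ∃ c, φ e = C c) ∧
      (∀ p, φ (ra p.1, xc p) = X p) ∧ (∀ p, φ (yr p, xc p) = 1) ∧ (∀ p, φ (yr p, cb p.2) = 1) ∧
      (∀ c, (∀ b', cb b' ≠ c) → (∀ p, xc p ≠ c) → φ (μ c, c) = 1) ∧
      (∀ r c, φ (r, c) ≠ 0 → (∃ p, c = xc p ∧ (r = ra p.1 ∨ r = yr p)) ∨
        (∃ p, c = cb p.2 ∧ r = yr p) ∨ ((∀ b', cb b' ≠ c) ∧ (∀ p, xc p ≠ c) ∧ r = μ c)) := by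
  classical
  -- the cells sent to `1`
  let U : Fin n × Fin n → Prop := fun e => (∃ p, e = (yr p, xc p)) ∨ (∃ p, e = (yr p, cb p.2)) ∨
    ∃ c, (∀ b', cb b' ≠ c) ∧ (∀ p, xc p ≠ c) ∧ e = (μ c, c)
  refine ⟨fun e => if h : ∃ p, e = (ra p.1, xc p) then X h.choose else if U e then 1 else 0,
    fun e => ?_, fun p => ?_, fun p => ?_, fun p => ?_, fun c hc1 hc2 => ?_, fun r c hne => ?_⟩
  · by_cases h : ∃ p, e = (ra p.1, xc p)
    · exact Or.inl ⟨h.choose, by simp only [dif_pos h]⟩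
    · by_cases hU : U e
      · exact Or.inr ⟨1, by simp only [dif_neg h, if_pos hU, C_1]⟩
      · exact Or.inr ⟨0, by simp only [dif_neg h, if_neg hU, C_0]⟩
  · have h : ∃ q, (ra p.1, xc p) = (ra q.1, xc q) := ⟨p, rfl⟩
    have hq : h.choose = p := (hxc (Prod.mk.inj h.choose_spec).2).symm
    simp only [dif_pos h, hq]
  · have h : ¬ ∃ q, (yr p, xc p) = (ra q.1, xc q) :=
      fun ⟨q, hq⟩ => hry q.1 p (Prod.mk.inj hq).1.symm
    have hU : U (yr p, xc p) := Or.inl ⟨p, rfl⟩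
    simp only [dif_neg h, if_pos hU]
  · have h : ¬ ∃ q, (yr p, cb p.2) = (ra q.1, xc q) :=
      fun ⟨q, hq⟩ => hry q.1 p (Prod.mk.inj hq).1.symm
    have hU : U (yr p, cb p.2) := Or.inr (Or.inl ⟨p, rfl⟩)
    simp only [dif_neg h, if_pos hU]
  · have h : ¬ ∃ q, (μ c, c) = (ra q.1, xc q) := fun ⟨q, hq⟩ => hc2 q (Prod.mk.inj hq).2.symm
    have hU : U (μ c, c) := Or.inr (Or.inr ⟨c, hc1, hc2, rfl⟩)
    simp only [dif_neg h, if_pos hU]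
  · by_cases h : ∃ q, (r, c) = (ra q.1, xc q)
    · obtain ⟨q, hq⟩ := h
      obtain ⟨h1, h2⟩ := Prod.mk.inj hq
      exact Or.inl ⟨q, h2, Or.inl h1⟩
    · by_cases hU : U (r, c)
      · rcases hU with ⟨q, hq⟩ | ⟨q, hq⟩ | ⟨c', hc1, hc2, hq⟩
        · obtain ⟨h1, h2⟩ := Prod.mk.inj hq
          exact Or.inl ⟨q, h2, Or.inr h1⟩
        · obtain ⟨h1, h2⟩ := Prod.mk.inj hq
          exact Or.inr (Or.inl ⟨q, h2, h1⟩)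
        · obtain ⟨h1, h2⟩ := Prod.mk.inj hq
          subst h2
          exact Or.inr (Or.inr ⟨hc1, hc2, h1⟩)
      · exfalso
        apply hne
        simp only [dif_neg h, if_neg hU]

/-! ### Lifts of the permutations of `Fin b` -/

/-- **The lift `σ_g` of a permutation `g` of `Fin b` exists**: the lift function
(`cb b' ↦ yr (g b', b')`, `xc (g b', b') ↦ ra (g b')`, the other `xc p ↦ yr p`, leftover
`c ↦ μ c`) is injective — its values on the three kinds of columns are `yr p` with `g p.2 = p.1`,
`ra a` or `yr p` with `g p.2 ≠ p.1`, and leftover rows `μ c`, pairwise distinct — hence a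
permutation of `Fin n`. [folklore] -/
theorem exists_lift (hra : Function.Injective ra) (hcb : Function.Injective cb)
    (hxc : Function.Injective xc) (hyr : Function.Injective yr) (hry : ∀ a p, ra a ≠ yr p)
    (hcx : ∀ b' p, cb b' ≠ xc p)
    (hμ : ∀ c : Fin n, (∀ b', cb b' ≠ c) → (∀ p, xc p ≠ c) →
      (∀ a, ra a ≠ μ c) ∧ (∀ p, yr p ≠ μ c) ∧ (μ c, c) ∈ A)
    (g : Equiv.Perm (Fin b)) :
    ∃ σ : Equiv.Perm (Fin n), (∀ b', σ (cb b') = yr (g b', b')) ∧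
      (∀ b', σ (xc (g b', b')) = ra (g b')) ∧ (∀ p, g p.2 ≠ p.1 → σ (xc p) = yr p) ∧
      (∀ c, (∀ b', cb b' ≠ c) → (∀ p, xc p ≠ c) → σ c = μ c) := by
  classical
  -- the lift FUNCTION `f` and its values on the three kinds of columns
  obtain ⟨f, f1, f2, f3, f4⟩ : ∃ f : Fin n → Fin n, (∀ b', f (cb b') = yr (g b', b')) ∧
      (∀ b', f (xc (g b', b')) = ra (g b')) ∧ (∀ p, g p.2 ≠ p.1 → f (xc p) = yr p) ∧
      (∀ c, (∀ b', cb b' ≠ c) → (∀ p, xc p ≠ c) → f c = μ c) := by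
    refine ⟨fun i => if h : ∃ b', cb b' = i then yr (g h.choose, h.choose)
        else if h' : ∃ p, xc p = i then
          (if g h'.choose.2 = h'.choose.1 then ra h'.choose.1 else yr h'.choose)
        else μ i, fun b' => ?_, fun b' => ?_, fun p hp => ?_, fun c hc1 hc2 => ?_⟩
    · have h : ∃ b'', cb b'' = cb b' := ⟨b', rfl⟩
      have hb : h.choose = b' := hcb h.choose_spec
      simp only [dif_pos h, hb]
    · have h : ¬ ∃ b'', cb b'' = xc (g b', b') := fun ⟨b'', hb''⟩ => hcx b'' _ hb''
      have h' : ∃ p, xc p = xc (g b', b') := ⟨_, rfl⟩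
      have hp : h'.choose = (g b', b') := hxc h'.choose_spec
      simp only [dif_neg h, dif_pos h', hp, if_true]
    · have h : ¬ ∃ b'', cb b'' = xc p := fun ⟨b'', hb''⟩ => hcx b'' _ hb''
      have h' : ∃ q, xc q = xc p := ⟨_, rfl⟩
      have hq : h'.choose = p := hxc h'.choose_spec
      simp only [dif_neg h, dif_pos h', hq, if_neg hp]
    · have h : ¬ ∃ b'', cb b'' = c := fun ⟨b'', hb''⟩ => hc1 b'' hb''
      have h' : ¬ ∃ q, xc q = c := fun ⟨q, hq⟩ => hc2 q hq
      simp only [dif_neg h, dif_neg h']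
  have f2' : ∀ p, g p.2 = p.1 → f (xc p) = ra p.1 := by
    rintro ⟨a, b'⟩ h
    simp only at h
    subst h
    exact f2 b'
  suffices hinj : Function.Injective f from
    ⟨Equiv.ofBijective f hinj.bijective_of_finite, f1, f2, f3, f4⟩
  intro i j hij
  rcases col_cases cb xc j with ⟨b', rfl⟩ | ⟨p, rfl⟩ | ⟨hj1, hj2⟩
  · rw [f1] at hij
    rcases col_cases cb xc i with ⟨b'', rfl⟩ | ⟨q, rfl⟩ | ⟨hi1, hi2⟩
    · rw [f1] at hij
      rw [(Prod.mk.inj (hyr hij)).2]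
    · by_cases hq : g q.2 = q.1
      · rw [f2' q hq] at hij
        exact absurd hij (hry _ _)
      · rw [f3 q hq] at hij
        obtain rfl := hyr hij
        exact (hq rfl).elim
    · rw [f4 i hi1 hi2] at hij
      exact absurd hij.symm ((hμ i hi1 hi2).2.1 _)
  · by_cases hp : g p.2 = p.1
    · rw [f2' p hp] at hij
      rcases col_cases cb xc i with ⟨b'', rfl⟩ | ⟨q, rfl⟩ | ⟨hi1, hi2⟩
      · rw [f1] at hij
        exact absurd hij.symm (hry _ _)
      · by_cases hq : g q.2 = q.1
        · rw [f2' q hq] at hij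
          have h1 : q.1 = p.1 := hra hij
          rw [Prod.ext h1 (g.injective (by rw [hq, hp, h1]))]
        · rw [f3 q hq] at hij
          exact absurd hij.symm (hry _ _)
      · rw [f4 i hi1 hi2] at hij
        exact absurd hij.symm ((hμ i hi1 hi2).1 _)
    · rw [f3 p hp] at hij
      rcases col_cases cb xc i with ⟨b'', rfl⟩ | ⟨q, rfl⟩ | ⟨hi1, hi2⟩
      · rw [f1] at hij
        obtain rfl := hyr hij
        exact (hp rfl).elim
      · by_cases hq : g q.2 = q.1
        · rw [f2' q hq] at hij
          exact absurd hij (hry _ _)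
        · rw [f3 q hq] at hij
          rw [hyr hij]
      · rw [f4 i hi1 hi2] at hij
        exact absurd hij.symm ((hμ i hi1 hi2).2.1 _)
  · rw [f4 j hj1 hj2] at hij
    rcases col_cases cb xc i with ⟨b'', rfl⟩ | ⟨q, rfl⟩ | ⟨hi1, hi2⟩
    · rw [f1] at hij
      exact absurd hij ((hμ j hj1 hj2).2.1 _)
    · by_cases hq : g q.2 = q.1
      · rw [f2' q hq] at hij
        exact absurd hij ((hμ j hj1 hj2).1 _)
      · rw [f3 q hq] at hij
        exact absurd hij ((hμ j hj1 hj2).2.1 _)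
    · rw [f4 i hi1 hi2] at hij
      exact μ.injective hij

/-! ### The survivors are the lifts -/

/-- **A designated matching is a lift.**  In a DESIGNATED matching `σ` (path columns go to their
`ra` or `yr` row, core columns to a `yr` row of their own index, leftover columns along `μ`):
if `xc (a, b') ↦ ra a` then the row `yr (a, b')` can only be covered by `cb b'` (`hK`); every core
row `ra a` is covered by some `xc (a, b')`, so `g` (`cb b' ↦ yr (g b', b')`) is onto, hence a
permutation of `Fin b`, and `σ` is its lift. [folklore] -/
theorem exists_perm_of_designated (hra : Function.Injective ra) (hyr : Function.Injective yr)
    (hry : ∀ a p, ra a ≠ yr p) (hcx : ∀ b' p, cb b' ≠ xc p)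
    (hμ : ∀ c : Fin n, (∀ b', cb b' ≠ c) → (∀ p, xc p ≠ c) →
      (∀ a, ra a ≠ μ c) ∧ (∀ p, yr p ≠ μ c) ∧ (μ c, c) ∈ A)
    {σ : Equiv.Perm (Fin n)} (hD1 : ∀ p, σ (xc p) = ra p.1 ∨ σ (xc p) = yr p)
    (hD2 : ∀ b', ∃ a, σ (cb b') = yr (a, b'))
    (hD3 : ∀ c, (∀ b', cb b' ≠ c) → (∀ p, xc p ≠ c) → σ c = μ c) :
    ∃ g : Equiv.Perm (Fin b), (∀ b', σ (cb b') = yr (g b', b')) ∧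
      (∀ b', σ (xc (g b', b')) = ra (g b')) ∧ (∀ p, g p.2 ≠ p.1 → σ (xc p) = yr p) := by
  choose g hg using hD2
  have hK : ∀ a b', σ (xc (a, b')) = ra a → σ (cb b') = yr (a, b') := by
    intro a b' h
    obtain ⟨j, hj⟩ := σ.surjective (yr (a, b'))
    rcases col_cases cb xc j with ⟨b'', rfl⟩ | ⟨q, rfl⟩ | ⟨hj1, hj2⟩
    · rw [hg] at hj
      obtain ⟨rfl, rfl⟩ := Prod.mk.inj (hyr hj)
      exact hg _
    · rcases hD1 q with hq | hq
      · rw [hq] at hj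
        exact absurd hj (hry _ _)
      · rw [hq] at hj
        obtain rfl : q = (a, b') := hyr hj
        exact absurd (h.symm.trans hq) (hry _ _)
    · rw [hD3 j hj1 hj2] at hj
      exact absurd hj.symm ((hμ j hj1 hj2).2.1 _)
  have hsurj : Function.Surjective g := by
    intro a
    obtain ⟨j, hj⟩ := σ.surjective (ra a)
    rcases col_cases cb xc j with ⟨b'', rfl⟩ | ⟨q, rfl⟩ | ⟨hj1, hj2⟩
    · rw [hg] at hj
      exact absurd hj.symm (hry _ _)
    · rcases hD1 q with hq | hq
      · obtain ⟨a', b'⟩ := q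
        obtain rfl : a' = a := hra (hq.symm.trans hj)
        exact ⟨b', (Prod.mk.inj (hyr ((hg b').symm.trans (hK _ _ hq)))).1⟩
      · rw [hq] at hj
        exact absurd hj.symm (hry _ _)
    · rw [hD3 j hj1 hj2] at hj
      exact absurd hj.symm ((hμ j hj1 hj2).1 _)
  refine ⟨Equiv.ofBijective g hsurj.bijective_of_finite, hg, fun b' => ?_, fun p hp => ?_⟩
  · rcases hD1 (g b', b') with h | h
    · exact h
    · exact absurd (σ.injective (h.trans (hg b').symm)).symm (hcx b' (g b', b'))
  · rcases hD1 p with h | h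
    · exact absurd (Prod.mk.inj (hyr ((hg p.2).symm.trans (hK p.1 p.2 h)))).1 hp
    · exact h

/-! ### The image of the face permanent -/

/-- **The gadget substitution sends `per_A` to `per_b`.**  The lifts `σ_g` are matchings of `A` sent
to `x^{μ_g}` (the only non-unit factors sit on the columns `xc (g b', b')`), `g ↦ σ_g` is injective,
and a matching of `A` with nonzero image is designated, hence a lift (`exists_perm_of_designated`;
two lifts of the same `g` agree column by column). [folklore] -/
theorem aeval_facePer_eq_perPoly (hra : Function.Injective ra) (hcb : Function.Injective cb)
    (hxc : Function.Injective xc) (hyr : Function.Injective yr) (hry : ∀ a p, ra a ≠ yr p)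
    (hcx : ∀ b' p, cb b' ≠ xc p)
    (hA : ∀ p : Fin b × Fin b, (ra p.1, xc p) ∈ A ∧ (yr p, xc p) ∈ A ∧ (yr p, cb p.2) ∈ A)
    (hμ : ∀ c : Fin n, (∀ b', cb b' ≠ c) → (∀ p, xc p ≠ c) →
      (∀ a, ra a ≠ μ c) ∧ (∀ p, yr p ≠ μ c) ∧ (μ c, c) ∈ A)
    {φ : Fin n × Fin n → MvPolynomial (Fin b × Fin b) ℝ≥0}
    (hφX : ∀ p, φ (ra p.1, xc p) = X p) (hφ1 : ∀ p, φ (yr p, xc p) = 1)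
    (hφ2 : ∀ p, φ (yr p, cb p.2) = 1)
    (hφ3 : ∀ c, (∀ b', cb b' ≠ c) → (∀ p, xc p ≠ c) → φ (μ c, c) = 1)
    (hφ0 : ∀ r c, φ (r, c) ≠ 0 → (∃ p, c = xc p ∧ (r = ra p.1 ∨ r = yr p)) ∨
      (∃ p, c = cb p.2 ∧ r = yr p) ∨ ((∀ b', cb b' ≠ c) ∧ (∀ p, xc p ≠ c) ∧ r = μ c)) :
    aeval φ (facePer A) = perPoly (Fin b) ℝ≥0 := by
  classical
  choose lift h1 h2 h3 h4 using exists_lift hra hcb hxc hyr hry hcx hμ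
  have hinj : Function.Injective lift := fun g g' h =>
    Equiv.ext fun b' => (Prod.mk.inj (hyr ((h1 g b').symm.trans (by rw [h, h1])))).1
  rw [facePer, map_sum, perPoly_eq_sum_monomial]
  simp_rw [monomial_permMonomial_eq_prod, map_prod, aeval_X]
  -- the lifts are sent to the permutation monomials
  have hR : ∑ g : Equiv.Perm (Fin b), ∏ i, (X (g i, i) : MvPolynomial (Fin b × Fin b) ℝ≥0) =
      ∑ σ ∈ Finset.univ.image lift, ∏ i, φ (σ i, i) := by
    rw [Finset.sum_image fun g _ g' _ h => hinj h]
    refine Finset.sum_congr rfl fun g _ => ?_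
    symm
    rw [← Finset.prod_subset (Finset.subset_univ (Finset.univ.image fun b' => xc (g b', b'))),
      Finset.prod_image fun b₁ _ b₂ _ h => (Prod.mk.inj (hxc h)).2]
    · refine Finset.prod_congr rfl fun b' _ => ?_
      rw [h2]
      exact hφX (g b', b')
    · intro i _ hi
      rcases col_cases cb xc i with ⟨b', rfl⟩ | ⟨p, rfl⟩ | ⟨hi1, hi2⟩
      · rw [h1]
        exact hφ2 (g b', b')
      · have hp : g p.2 ≠ p.1 := fun h =>
          hi (Finset.mem_image.2 ⟨p.2, Finset.mem_univ _, by rw [h]⟩)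
        rw [h3 g p hp]
        exact hφ1 p
      · rw [h4 g i hi1 hi2]
        exact hφ3 i hi1 hi2
  rw [hR]
  symm
  refine Finset.sum_subset (fun σ hσ => ?_) (fun σ _ hσ => ?_)
  · -- a lift is a matching of `A`
    obtain ⟨g, -, rfl⟩ := Finset.mem_image.1 hσ
    refine Finset.mem_filter.2 ⟨Finset.mem_univ _, fun i => ?_⟩
    rcases col_cases cb xc i with ⟨b', rfl⟩ | ⟨p, rfl⟩ | ⟨hi1, hi2⟩
    · rw [h1]
      exact (hA (g b', b')).2.2
    · by_cases hp : g p.2 = p.1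
      · obtain ⟨a, b'⟩ := p
        simp only at hp
        subst hp
        rw [h2]
        exact (hA (g b', b')).1
      · rw [h3 g p hp]
        exact (hA p).2.1
    · rw [h4 g i hi1 hi2]
      exact (hμ i hi1 hi2).2.2
  · -- a matching of `A` with nonzero image is designated, hence a lift
    by_contra hne
    have hz : ∀ i, φ (σ i, i) ≠ 0 := fun i h0 => hne (Finset.prod_eq_zero (Finset.mem_univ i) h0)
    have hD1 : ∀ p, σ (xc p) = ra p.1 ∨ σ (xc p) = yr p := fun p => by
      rcases hφ0 _ _ (hz (xc p)) with ⟨q, hq, h⟩ | ⟨q, hq, _⟩ | ⟨_, h, _⟩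
      · obtain rfl : q = p := hxc hq.symm
        exact h
      · exact absurd hq.symm (hcx q.2 p)
      · exact absurd rfl (h p)
    have hD2 : ∀ b', ∃ a, σ (cb b') = yr (a, b') := fun b' => by
      rcases hφ0 _ _ (hz (cb b')) with ⟨q, hq, _⟩ | ⟨q, hq, h⟩ | ⟨h, _, _⟩
      · exact absurd hq (hcx b' q)
      · obtain rfl : b' = q.2 := hcb hq
        exact ⟨q.1, h⟩
      · exact absurd rfl (h b')
    have hD3 : ∀ c, (∀ b', cb b' ≠ c) → (∀ p, xc p ≠ c) → σ c = μ c := fun c hc1 hc2 => by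
      rcases hφ0 _ _ (hz c) with ⟨q, hq, _⟩ | ⟨q, hq, _⟩ | ⟨_, _, h⟩
      · exact absurd hq.symm (hc2 q)
      · exact absurd hq.symm (hc1 q.2)
      · exact h
    obtain ⟨g, k1, k2, k3⟩ := exists_perm_of_designated hra hyr hry hcx hμ hD1 hD2 hD3
    refine hσ (Finset.mem_image.2 ⟨g, Finset.mem_univ _, Equiv.ext fun i => ?_⟩)
    rcases col_cases cb xc i with ⟨b', rfl⟩ | ⟨p, rfl⟩ | ⟨hi1, hi2⟩
    · rw [h1, k1]
    · by_cases hp : g p.2 = p.1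
      · obtain ⟨a, b'⟩ := p
        simp only at hp
        subst hp
        rw [h2, k2]
      · rw [h3 g p hp, k3 p hp]
    · rw [h4 g i hi1 hi2, hD3 i hi1 hi2]

/-! ### The stub -/

/-- **Gadget projection (stub `stub_gadgetProjection` of line `Sketch_ideator4`).**  If the cell set
`A` contains a placed gadget of order `b` — core rows `ra`, core columns `cb`, chord paths
`ra a — xc (a,b') — yr (a,b') — cb b'`, and a matching `c ↦ μ c` of the leftover columns into the
leftover rows inside `A` — then `L⁺(per_b) ≤ L⁺(per_A)`: the gadget substitution (`exists_subst`)
is a Valiant projection (`complexity_le_of_isProjection`) sending `per_A` to `per_b`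
(`aeval_facePer_eq_perPoly`). [folklore] -/
theorem stub_gadgetProjection :
    ∀ (n b : ℕ) (A : Finset (Fin n × Fin n)) (ra cb : Fin b → Fin n)
      (xc yr : Fin b × Fin b → Fin n) (μ : Equiv.Perm (Fin n)),
      Function.Injective ra → Function.Injective cb → Function.Injective xc → Function.Injective yr →
      (∀ a p, ra a ≠ yr p) → (∀ b' p, cb b' ≠ xc p) →
      (∀ p : Fin b × Fin b, (ra p.1, xc p) ∈ A ∧ (yr p, xc p) ∈ A ∧ (yr p, cb p.2) ∈ A) →
      (∀ c : Fin n, (∀ b', cb b' ≠ c) → (∀ p, xc p ≠ c) →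
        (∀ a, ra a ≠ μ c) ∧ (∀ p, yr p ≠ μ c) ∧ (μ c, c) ∈ A) →
      complexity (perPoly (Fin b) ℝ≥0) ≤ complexity (facePer A) := by
  intro n b A ra cb xc yr μ hra hcb hxc hyr hry hcx hA hμ
  obtain ⟨φ, hproj, hφX, hφ1, hφ2, hφ3, hφ0⟩ := exists_subst (cb := cb) (μ := μ) hxc hry
  exact complexity_le_of_isProjection ⟨φ, hproj,
    (aeval_facePer_eq_perPoly hra hcb hxc hyr hry hcx hA hμ hφX hφ1 hφ2 hφ3 hφ0).symm⟩

end Summit.ValiantsHypothesis.ValiantsHypothesis.Theorems.DivisionGap.PerCofactorDegreeReduction.GadgetProjection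

end
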